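import Summits.QuantumFields.BalabanUV.T4Continuum.Support.B13TermDataOpSecant
import Summits.QuantumFields.BalabanUV.T4Continuum.Support.B13HistWitness
import Summits.QuantumFields.BalabanUV.T4Continuum.Support.B13StepEndWitness

/-!
# NE5 ∕ U3 — term-format slots, part 5: NON-VACUITY.  The ZERO-CORE term-format package on ANY pair of runs `R`: route P2's four
# per-term one-run shapes `Admissible ∧ Geometry ∧ ReadLip ∧ RefAt` are JOINTLY INHABITED by a term datum of record, and part 4's END
# `ne5_of_record_secant_termData_termwise` FIRES for it — the combined P1 + P2 binder list of E8[rec] for term-format slots is consistent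
# (row O1-d2 follower; parts 1–4 = p212301, p212552, p213119, p213462)

Cell `pub-balaban`, unit `b2b-balaban-t4-ne5-formalise-leaf-08` (NE5 formalisation swarm, LEAF PROVER 08, gen 2).  Summits-side bookkeeping
(NOT a Literature module).  HONEST FRAMING: rung (B)+1 of the FINITE-VOLUME T⁴ programme — NOT infinite volume, NOT a mass gap, NOT the
Clay problem, NOT NE5 (NOT PRINTED; GAPS G-t4-U3-1).  HONEST DEPENDENCY (cell line, verbatim): continuum YM on T⁴ ⇐ BetaPertH ∧ nine
spine estimates (0/9 proved); BetaPertH ⇐ (D1) ∧ (D4) ∧ CAP+tail; G-an2-4 gates asym, D1 and NE2/3/4.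

WHAT (the pattern of leaf-10's `B13StepEndWitness` and leaf-06's `B13HistWitness`, for the term-format END of parts 3–4).  On Bałaban's
carriers of record `R : B13Carriers.TwoRuns 𝔾`: a toy measurable potential frame `toyFrame R` (arguments `Unit`, no bonds, leaf-06's
`toyConsts`); the ZERO term core (no Gaussian variables — `κ = ι = Empty` —, no history labels, measure `0`, untilted integrand `0`,
normalisation `∫ 1 d(dirac) = 1`), term constants `toyConsts` (`a = u = u′ = u₀ = u₀′ = M₀′ = ζ = 1`, everything else `0`), B13 weights
`toyWeights`, the zero insertion datum over `B13HistM (toyFrame R)`, margins `1` ⟹ the term-format slot package `zeroTS R`.  THEN: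
* §2 route P2's shapes HOLD for every term of record: `admissible_toy`, `geometry_zero`, `readLip_zero`, **`refAt_zero` (at EVERY input
  point)** — so `TermConsts.Admissible` (27 inequalities among constants) and `RefAt` are satisfiable as typed, jointly with `Geometry` and
  `ReadLip` on one datum;
* §3 the model of record of `zeroTS R` has zero output (`act_zero`, `out_zero`, `outA_zero`, `outB_zero`) and every non-W2 binder of the END
  holds with zero constants (reading, slice budgets, levels, raw bounds, entry rate, insertion species, …, as in leaf-10's file but over
  the MEASURABLE history space), the two per-term numbers vanish (`size = 0`, `ampOp … 0 = 0`), the (2.38)-shaped budgets hold with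
  `ε = εop = 0`;
* §4 **`end_fires_zeroTS`**: `∃ C₅, NE5 (outA (zeroTS R).toSlots 0 0) (outB (zeroTS R).toSlots 0 0) W κ 1 C₅` BY part 4's
  `ne5_of_record_secant_termData_termwise` — every one of its binders discharged for the zero package.
A consistency witness; nothing about [II]'s objects; NE5 NOT PROVED.  0 sorry; axioms ⊆ {propext, Classical.choice, Quot.sound}.
-/

noncomputable section

open MeasureTheory
open scoped BigOperators

namespace Summit.QuantumFields.BalabanUV.T4Continuum.B13TermDataWitness

open Literature.MathematicalPhysics.QuantumFieldTheory.Balaban1983to89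
open Literature.MathematicalPhysics.QuantumFieldTheory.Balaban1983to89.T4OutputRate (Carriers DecayBound NE5)
open Literature.MathematicalPhysics.QuantumFieldTheory.Balaban1983to89.T4InputCauchyRateData (StepModel)
open Literature.MathematicalPhysics.QuantumFieldTheory.Balaban1983to89.T4ActivityTilt (domForm)
open Summit.QuantumFields.BalabanUV.T4Continuum.ActivityTermModel (TermDatum TermConsts)
open Summit.QuantumFields.BalabanUV.T4Continuum.B13OpDatum (Format OpDatum Species B13Weights)
open Summit.QuantumFields.BalabanUV.T4Continuum.B13OpDatumJunctions (RawBounded WeightedEntrywiseRate)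
open Summit.QuantumFields.BalabanUV.T4Continuum.B13HistDatum (level136)
open Summit.QuantumFields.BalabanUV.T4Continuum.B13HistMeasurable (MeasPotFrame B13HistM)
open Summit.QuantumFields.BalabanUV.T4Continuum.B13HistInsertion (InsDatum)
open Summit.QuantumFields.BalabanUV.T4Continuum.B13StepTermFamily (out)
open Summit.QuantumFields.BalabanUV.T4Continuum.B13StepTermExpLinear (actOf)
open Summit.QuantumFields.BalabanUV.T4Continuum.B13Carriers (TwoRuns)
open Summit.QuantumFields.BalabanUV.T4Continuum.B13StepTermLabels (TermIdx InnerLabel)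
open Summit.QuantumFields.BalabanUV.T4Continuum.B13StepTermSocket (labelsIndexing touchInc)
open Summit.QuantumFields.BalabanUV.T4Continuum.B13InnerData (Bnd b13InnerData)
open Summit.QuantumFields.BalabanUV.T4Continuum.UrsellTermBudget (actSum)
open Summit.QuantumFields.BalabanUV.T4Continuum.B13Represents (Assembly)
open Summit.QuantumFields.BalabanUV.T4Continuum.B13StepOfRecord (Slots assembly step outA outB)
open Summit.QuantumFields.BalabanUV.T4Continuum.B13TermData (TermCore termData)
open Summit.QuantumFields.BalabanUV.T4Continuum.B13StepOfRecordTermData (TermSlots)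
open Summit.QuantumFields.BalabanUV.T4Continuum.B13TermDataOpSecant (ne5_of_record_secant_termData_termwise)
open Summit.QuantumFields.BalabanUV.T4Continuum.B13StepEndWitness (out_zero_act recA_eq_zero_of_out recB_eq_zero_of_out)

variable {𝔾 : Type} [GaugeGroup 𝔾] (R : TwoRuns 𝔾)

/-! ## §1 The toy frame, the zero core, the toy constants and weights, the zero package -/

/-- [folklore] DATA: a toy measurable potential frame on the carriers of record — arguments `Unit`, no bonds, leaf-06's `toyConsts`. -/
def toyFrame : MeasPotFrame R.carriers where
  Arg := fun _ => Unit
  Bond := fun _ => Empty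
  finBond := fun _ => inferInstance
  Bv := fun _ _ b => b.elim
  vol := fun _ => 0
  consts := B13HistWitness.toyConsts
  pos := B13HistWitness.toy_posUnits
  meas := fun _ => inferInstance
  measurable_Bv := fun _ b => b.elim

/-- [folklore] DATA: the ZERO term core — slot `()`, no history labels, field maps into `Unit`, measure `0` (no Gaussian variables:
`κ = ι = Empty`), untilted integrand `0`, normalisation data `(dirac (), 1)`. -/
def zeroCore : TermCore (toyFrame R) (fun Y : R.carriers.Dom => Y) Unit Empty Empty Unit Unit Unit where
  slot := ()
  D := ∅
  bonds := fun _ => ∅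
  cubes := fun _ => ∅
  cubes₀ := ∅
  B := fun _ _ => ()
  measB := fun _ => measurable_const
  ν := 0
  sigmaFinite := inferInstance
  F₀ := fun _ => 0
  Xf := fun _ i => i.elim
  Bf := fun _ a => a.elim
  ν₀ := Measure.dirac ()
  φ₀ := fun _ => 1
  B₀f := fun _ a => a.elim

/-- [folklore] DATA: toy term constants — `a = u = u′ = u₀ = u₀′ = M₀′ = ζ = 1`, all other letters `0`. -/
def toyConsts : TermConsts := ⟨0, 0, 1, 0, 0, 0, 0, 0, 0, 0, 0, 0, 0, 0, 0, 0, 0, 1, 1, 0, 1, 1, 1, 1⟩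

/-- [folklore] DATA: toy B13 weights — distance `0`, contour radii `1`, unit potential weights (no bond sites). -/
def toyWeights : B13Weights Empty Empty Unit R.carriers.Dom where
  d := fun _ _ => 0
  p := fun i => i.elim
  q := fun a => a.elim
  δ := 0
  τ := fun _ => 1
  w := fun _ => 1
  kk := fun b _ => b.elim
  v := fun _ => 1
  τ_ne := fun _ => one_ne_zero
  w_pos := fun _ => one_pos
  kk_pos := fun b _ => b.elim
  v_pos := fun _ => one_pos

/-- [folklore] DATA: the ZERO insertion datum over the measurable history space of the toy frame (age damping `½`). -/
def zeroIns : InsDatum R.carriers ℂ (B13HistM (toyFrame R)) where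
  base := fun _ _ => 0
  slice := fun _ _ _ _ => 0
  slice_add := fun _ _ _ _ _ => by simp
  slice_smul := fun _ _ _ _ _ => by simp
  slice_local := fun _ _ _ _ _ _ => rfl
  ω := 1 / 2
  insOpA := fun _ _ _ => 0
  insOpB := fun _ _ _ => 0

/-- [folklore] DATA: **THE ZERO TERM-FORMAT SLOT PACKAGE** on the carriers of record: B13 format of the toy weights at every step, raw species
`0`, the zero insertion datum, margins `1`, the zero core at every polymer and inner label. -/
def zeroTS : TermSlots R (toyFrame R) (fun Y : R.carriers.Dom => Y) Unit Empty Empty Unit Unit Unit Unit ℂ where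
  F := fun _ => (toyWeights R).format
  G := fun _ => toyWeights R
  rawA := fun _ _ _ _ => 0
  rawB := fun _ _ _ _ => 0
  D := zeroIns R
  rOp := fun _ => 1
  rHist := fun _ => 1
  rOp_pos := fun _ => one_pos
  rHist_pos := fun _ => one_pos
  core := fun _ _ => zeroCore R

/-! ## §2 Route P2's four per-term shapes HOLD for the zero package -/

/-- [folklore] **`TermConsts.Admissible` IS SATISFIABLE**: the toy constants are admissible (all 27 clauses by arithmetic). -/
theorem admissible_toy : toyConsts.Admissible := by
  constructor <;> norm_num [toyConsts]

variable (Z : R.carriers.Dom) (ℓ : InnerLabel R.carriers.Dom (Bnd R))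

/-- [folklore] The zero package's term datum of record at `(Z, ℓ)`: measure `0`, normalisation measure `dirac ()`, label set `∅` (`rfl`). -/
theorem zeroDatum_ν : (termData (zeroTS R).F (zeroTS R).G (zeroTS R).rHist (zeroTS R).core Z ℓ).ν = 0 := rfl
/-- [folklore] -/ theorem zeroDatum_ν₀ : (termData (zeroTS R).F (zeroTS R).G (zeroTS R).rHist (zeroTS R).core Z ℓ).ν₀ = Measure.dirac () := rfl
/-- [folklore] -/ theorem zeroDatum_D : (termData (zeroTS R).F (zeroTS R).G (zeroTS R).rHist (zeroTS R).core Z ℓ).D = ∅ := rfl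
/-- [folklore] -/ theorem zeroDatum_cubes₀ : (termData (zeroTS R).F (zeroTS R).G (zeroTS R).rHist (zeroTS R).core Z ℓ).cubes₀ = ∅ := rfl

/-- [folklore] The normalisation integrand of the zero datum is the constant `1` (no bond variables: `quad₀` over `Empty` is `0`). -/
theorem φ_zero (o : OpDatum (Species Unit Empty Empty Unit R.carriers.Dom)) (y : Unit) : (termData (zeroTS R).F (zeroTS R).G (zeroTS R).rHist (zeroTS R).core Z ℓ).φ o y = 1 := by
  simp [TermDatum.φ, TermDatum.quad₀, termData, TermCore.toTermDatum, zeroTS, zeroCore]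

/-- [folklore] Its normalisation is `z(o) = 1`. -/
theorem z_zero (o : OpDatum (Species Unit Empty Empty Unit R.carriers.Dom)) : (termData (zeroTS R).F (zeroTS R).G (zeroTS R).rHist (zeroTS R).core Z ℓ).z o = 1 := by
  rw [TermDatum.z, zeroDatum_ν₀]
  simp [φ_zero]

/-- [folklore] Its tilted integrand vanishes (untilted integrand `0`). -/
theorem F_zero (pt : OpDatum (Species Unit Empty Empty Unit R.carriers.Dom) × B13HistM (toyFrame R)) (x : Unit) :
    (termData (zeroTS R).F (zeroTS R).G (zeroTS R).rHist (zeroTS R).core Z ℓ).F pt x = 0 := by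
  simp [TermDatum.F, termData, TermCore.toTermDatum, zeroTS, zeroCore]

/-- [folklore] Its term vanishes at every input point (integral against the zero measure). -/
theorem term_zero (pt : OpDatum (Species Unit Empty Empty Unit R.carriers.Dom) × B13HistM (toyFrame R)) :
    (termData (zeroTS R).F (zeroTS R).G (zeroTS R).rHist (zeroTS R).core Z ℓ).term pt = 0 := by
  rw [TermDatum.term, zeroDatum_ν, integral_zero_measure, smul_zero]

/-- [folklore] **P2's `Geometry` HOLDS** for the zero datum with the toy constants (empty sums, empty label set, everything measurable). -/
theorem geometry_zero : (termData (zeroTS R).F (zeroTS R).G (zeroTS R).rHist (zeroTS R).core Z ℓ).Geometry toyConsts where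
  hd0 _ _ := le_rfl
  hsymm _ _ := rfl
  htri _ _ _ := by show (0 : ℝ) ≤ 0 + 0; norm_num
  hKι _ := by simp [toyConsts]
  hKκ _ := by simp [toyConsts]
  hw Y hY := absurd hY (by simp [zeroDatum_D])
  hk b := b.elim
  hW b := b.elim
  hrow b := b.elim
  hcol b := b.elim
  hv Y hY := absurd hY (by simp [zeroDatum_D])
  hmeet Y hY := absurd hY (by simp [zeroDatum_D])
  hpin c hc := absurd hc (by simp [zeroDatum_cubes₀])
  hPm := by rw [zeroDatum_ν]; exact aestronglyMeasurable_zero_measure _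
  hopm _ := by rw [zeroDatum_ν]; exact aestronglyMeasurable_zero_measure _
  hhistm _ := by rw [zeroDatum_ν]; exact aestronglyMeasurable_zero_measure _
  hq₀m _ := (measurable_of_countable _).aestronglyMeasurable
  hP₀m := (measurable_of_countable _).aestronglyMeasurable

/-- [folklore] **P2's `ReadLip` HOLDS** for the zero datum in the package's margins (no kernel entries; the history clauses are part 1's
theorems for `readVpp`). -/
theorem readLip_zero : (termData (zeroTS R).F (zeroTS R).G (zeroTS R).rHist (zeroTS R).core Z ℓ).ReadLip toyConsts ((zeroTS R).rOp (R.carriers.scale Z)) ((zeroTS R).rHist (R.carriers.scale Z)) where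
  hkL _ _ a := a.elim
  hkA _ _ i := i.elim
  hkP _ _ a := a.elim
  hkQ _ _ _ Y hY := absurd hY (by simp [zeroDatum_D])
  hkR _ _ _ Y hY := absurd hY (by simp [zeroDatum_D])
  hadd := ((zeroTS R).core Z ℓ).readAdditive_toTermDatum _ _ _
  hunit := ((zeroTS R).core Z ℓ).readUnitBound_toTermDatum _ _ ((zeroTS R).rHist_pos _)

/-- [folklore] **P2's `RefAt` HOLDS AT EVERY INPUT POINT** for the zero datum with the toy constants: no kernel entries (`Empty`
matrices have determinant `1`), the tilted integrand is integrable against the zero measure with majorant integral `0 = M′`, the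
normalisation integrand is integrable against `dirac ()` with majorant integral `1 = M₀′`, and `‖z‖ = 1 = ζ`. -/
theorem refAt_zero (pt : OpDatum (Species Unit Empty Empty Unit R.carriers.Dom) × B13HistM (toyFrame R)) :
    (termData (zeroTS R).F (zeroTS R).G (zeroTS R).rHist (zeroTS R).core Z ℓ).RefAt toyConsts pt where
  hL a := a.elim
  hRA _ i := i.elim
  hdA _ := by rw [Matrix.det_isEmpty]; exact isUnit_one
  hP := by rw [Matrix.det_isEmpty]; exact isUnit_one
  hC a := a.elim
  hF := by rw [zeroDatum_ν]; exact integrable_zero_measure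
  hI' := by rw [zeroDatum_ν]; exact integrable_zero_measure
  hM' := by rw [zeroDatum_ν, integral_zero_measure]; simp [toyConsts]
  hφ := by rw [zeroDatum_ν₀]; exact .of_finite
  hI0' := by rw [zeroDatum_ν₀]; exact .of_finite
  hM0' := by
    rw [zeroDatum_ν₀, integral_dirac]
    simp [φ_zero, toyConsts]
  hζ := by rw [z_zero, norm_one]; simp [toyConsts]

/-- [folklore] The two per-term numbers of parts 3–4 VANISH for the zero package: `size = 0` … -/
theorem size_toy : toyConsts.size = 0 := by simp [TermConsts.size, toyConsts]

/-- [folklore] … and `ampOp … 0 = 0` (every amplitude carries the factor `M′ = 0`). -/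
theorem ampOp_zero : (termData (zeroTS R).F (zeroTS R).G (zeroTS R).rHist (zeroTS R).core Z ℓ).ampOp toyConsts 0 = 0 := by
  simp [TermDatum.ampOp, toyConsts]

/-! ## §3 The model of record of the zero package: zero output, and every remaining binder of the END -/

/-- [folklore] The activity slot of the zero package is the zero functional. -/
theorem act_zero : (zeroTS R).toSlots.act = fun _ _ _ _ => 0 := by
  funext Z ℓ o h
  exact term_zero R Z ℓ (o, h)

variable (E₀ cB : ℝ)

/-- [folklore] Its model of record has zero output functional. -/
theorem out_zero (k : ℕ) (o : OpDatum (Species Unit Empty Empty Unit R.carriers.Dom)) (h : B13HistM (toyFrame R)) (X : R.carriers.Dom) :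
    (step (zeroTS R).toSlots E₀ cB).Out k o h X = 0 := by
  rw [TermSlots.step_Out_toSlots, ← TermSlots.toSlots_act, act_zero]
  exact out_zero_act _ _ k o h X

/-- [folklore] Its run-A output vanishes. -/
theorem outA_zero (g : ℕ → ℝ) (V : R.carriers.BgA) (X : R.carriers.Dom) : outA (zeroTS R).toSlots E₀ cB g V X = 0 :=
  recA_eq_zero_of_out (out_zero R E₀ cB) g V X

/-- [folklore] Its run-B output vanishes. -/
theorem outB_zero (g : ℕ → ℝ) (U : R.carriers.BgB) (X : R.carriers.Dom) : outB (zeroTS R).toSlots E₀ cB g U X = 0 :=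
  recB_eq_zero_of_out (out_zero R E₀ cB) g U X

/-- [folklore] The zero insertion datum's functional vanishes at every datum. -/
theorem ins_zero (k : ℕ) (a : ℂ) (t : R.carriers.Dom → ℝ) : (zeroIns R).ins k a t = 0 := by
  simp [InsDatum.ins, zeroIns]

variable (W : Set (ℕ → ℝ)) (κr : ℝ)

/-- [folklore] READING: run A's (zero) insertion-operator data are read at the transported background. -/
theorem transportReads_zero : (assembly (zeroTS R).toSlots).TransportReads W :=
  Assembly.transportReads_of_insOpAt _ (insOpA' := fun _ _ _ => (0 : ℂ)) (fun _ _ _ => rfl) W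

/-- [folklore] W3-KIND, run B, constant `0`. -/
theorem sliceBudgetB_zero : (assembly (zeroTS R).toSlots).SliceBudgetB W κr 0 := by
  intro k g _ U j T t _ _ _ _
  show ‖(0 : B13HistM (toyFrame R))‖ ≤ 1 * (0 * T)
  simp

/-- [folklore] W3-KIND, run A, constant `0`. -/
theorem sliceBudget_zero : (zeroTS R).D.SliceBudget (step (zeroTS R).toSlots E₀ cB) W κr 0 := by
  intro k g _ U j T t _ _ _ _
  show ‖(0 : B13HistM (toyFrame R))‖ ≤ 1 * (0 * T)
  simp

/-- [folklore] L05 at level `0`. -/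
theorem decayBound_outA_zero : DecayBound (outA (zeroTS R).toSlots E₀ cB) W 0 κr := by
  intro g _ V X
  rw [outA_zero, abs_zero, zero_mul]

/-- [folklore] L06 at level `0`. -/
theorem decayBound_outB_zero : DecayBound (outB (zeroTS R).toSlots E₀ cB) W 0 κr := by
  intro g _ U X
  rw [outB_zero, abs_zero, zero_mul]

/-- [folklore] Raw boundedness, run A at the transported background. -/
theorem rawBounded_rawAt_zero : RawBounded (zeroTS R).F (assembly (zeroTS R).toSlots).rawAt W :=
  fun _ _ _ _ => ⟨0, fun _ => by simp [Assembly.rawAt, assembly, TermSlots.toSlots, zeroTS]⟩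

/-- [folklore] Raw boundedness, run B. -/
theorem rawBounded_rawB_zero : RawBounded (zeroTS R).F (zeroTS R).rawB W :=
  fun _ _ _ _ => ⟨0, fun _ => by simp [zeroTS]⟩

/-- [folklore] Row NE2's entry rate with constant `0`. -/
theorem weightedEntrywiseRate_zero (rate : ℕ → ℝ) :
    WeightedEntrywiseRate (zeroTS R).F (assembly (zeroTS R).toSlots).rawAt (zeroTS R).rawB W 0 rate := by
  intro k g _ U e
  show ‖(0 : ℂ) - 0‖ ≤ 0 * rate k * ((toyWeights R).format (T := Unit) (Ω := Unit)).wt e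
  simp

/-- [folklore] The insertion-operator species of the zero datum (margin `1`): two-run rate `0` … -/
theorem insOpRate_zero (θ : ℝ) :
    ((zeroTS R).D.toInsOpModel (step (zeroTS R).toSlots E₀ cB) (fun _ => 1) (fun _ => one_pos)).InsOpRate W 0 θ := by
  intro k g _ U
  show ‖(0 : ℂ) - 0‖ ≤ 0 * θ ^ k * 1
  simp

/-- [folklore] … one-run envelope at level `0` … -/
theorem insOpEnvelope_zero :
    ((zeroTS R).D.toInsOpModel (step (zeroTS R).toSlots E₀ cB) (fun _ => 1) (fun _ => one_pos)).InsOpEnvelope W κr E₀ 0 := by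
  intro k g _ U t _ u _
  refine ⟨?_, fun ζ _ => ?_⟩
  · show DifferentiableOn ℂ (fun ζ : ℂ => (zeroIns R).ins k (0 + ζ • u) t) (Metric.closedBall 0 1)
    simp only [ins_zero]
    exact differentiableOn_const 0
  · show ‖(zeroIns R).ins k (0 + ζ • u) t‖ ≤ 0 * (1 : ℝ)
    rw [ins_zero, norm_zero, zero_mul]

/-- [folklore] … and one-run bound for run A at level `0`. -/
theorem insBoundA_zero :
    ((zeroTS R).D.toInsOpModel (step (zeroTS R).toSlots E₀ cB) (fun _ => 1) (fun _ => one_pos)).InsBoundA W κr E₀ 0 := by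
  intro k g _ U t _
  show ‖(zeroIns R).ins k 0 t‖ ≤ 0 * (1 : ℝ)
  rw [ins_zero, norm_zero, zero_mul]

/-- [folklore] The activity sum of the zero majorant vanishes. -/
theorem actSum_zero (k : ℕ) (X : R.carriers.Dom) :
    actSum (b13InnerData R) (fun (_ : R.carriers.Dom) (_ : InnerLabel R.carriers.Dom (Bnd R)) => (0 : ℝ)) k X = 0 := by
  simp [actSum]

/-! ## §4 The END fires for the zero term-format package -/

/-- [folklore] **NON-VACUITY OF THE TERM-FORMAT END OF RECORD.**  For EVERY pair of runs `R`, window `W` and rate `κ`: part 4's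
`ne5_of_record_secant_termData_termwise` FIRES for the zero package `zeroTS R` — its per-term one-run data (`admissible_toy`, `geometry_zero`,
`readLip_zero`, `refAt_zero` at base AND class points), reach `ρ₀ = 1`, the reading, both slice budgets (`0`), both levels (`0`), raw bounds,
the entry rate (`0`, rate `(½)^k`), the insertion-operator species (`Gi = δI = 0`, `rI = 1`), the (2.38)-shaped budgets of the two per-term
numbers (`A′ = Aop′ = 0`, `ε = εop = 0`, `Rt = 64·log 162 + 64`), `N̄ = 0`, radii `ROp = 1`, `RHist = 1`, and the numerics
(`θ = ½`, `θ′ = 1`, `ω = ½`) — so `∃ C₅, NE5 (outA …) (outB …) W κ 1 C₅`.  The COMBINED P1 + P2 binder list of E8[rec] for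
term-format slots is JOINTLY SATISFIABLE (no hidden clash between `Admissible`, `RefAt`, the budgets and the END's inequalities).
A consistency witness; nothing about [II]'s objects. -/
theorem end_fires_zeroTS (hκ : 0 ≤ κr) :
    ∃ C₅, NE5 (outA (zeroTS R).toSlots 0 0) (outB (zeroTS R).toSlots 0 0) W κr 1 C₅ :=
  ⟨_, ne5_of_record_secant_termData_termwise (zeroTS R) (fun _ _ => toyConsts) 0 0 (ROp := fun _ => 1) (RHist := fun _ => 1)
    (A' := fun _ _ _ _ _ => 0) (Aop' := fun _ _ _ _ _ => 0) (Nbar := 0) (ε := 0) (εop := 0) (Rt := 64 * Real.log 162 + 64)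
    (EA₀ := 0) (E₁ := 1) (cA := 0) (c₁ := 0) (r₀ := 1) (Gi := 0) (δI := 0) (ρ₁ := 0) (θ := 1 / 2) (ρ₀ := 1) (B := 0) (k₀ := 0)
    (k₁ := 0) (fun _ => 1) (fun _ => one_pos)
    (fun _ _ => admissible_toy) (fun Z ℓ => geometry_zero R Z ℓ) (fun Z ℓ => readLip_zero R Z ℓ)
    (fun _ _ _ _ p _ _ _ i _ m => refAt_zero R _ _ p) (fun _ _ _ _ q _ _ _ i _ m => refAt_zero R _ _ q) zero_le_one le_rfl
    (transportReads_zero R W) (sliceBudgetB_zero R W κr) (sliceBudget_zero R 0 0 W κr) (decayBound_outA_zero R 0 0 W κr)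
    (decayBound_outB_zero R 0 0 W κr) (rawBounded_rawAt_zero R W) (rawBounded_rawB_zero R W)
    (weightedEntrywiseRate_zero R W fun k => (1 / 2 : ℝ) ^ k) (fun _ => le_rfl) (insOpEnvelope_zero R 0 0 W κr)
    (insBoundA_zero R 0 0 W κr) (insOpRate_zero R 0 0 W (1 / 2)) le_rfl le_rfl zero_lt_one (by norm_num)
    (fun _ _ _ _ _ => le_rfl)
    (fun _ _ _ Z ℓ => by rw [size_toy, ampOp_zero, add_zero, zero_mul]) le_rfl
    (fun k g _ U Z _ => by rw [actSum_zero, zero_mul]) (by norm_num)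
    le_rfl (fun k Z ℓ => by simp [zeroTS, zeroCore])
    (fun _ _ _ _ _ => le_rfl) hκ (fun _ _ _ Z ℓ => by rw [size_toy, zero_mul]) le_rfl
    (fun k g _ U Z _ => by rw [actSum_zero, zero_mul]) le_rfl (by norm_num)
    (fun _ => by norm_num) (fun _ => by simp [Assembly.bHist]) (fun _ => by simp [zeroTS, zeroIns])
    le_rfl le_rfl one_pos le_rfl le_rfl le_rfl one_pos (by norm_num) (by norm_num) le_rfl
    (by show (0 : ℝ) < 1 / 2; norm_num) (by show (1 / 2 : ℝ) < 1; norm_num) (by norm_num) le_rfl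
    (fun _ h => absurd h (Nat.not_lt_zero _)) (by show (1 / 2 : ℝ) + 2 * (0 * _) * 0 < 1; norm_num)⟩

end Summit.QuantumFields.BalabanUV.T4Continuum.B13TermDataWitness

end
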